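/-
Copyright (c) 2026 the pub-hodgecm-mathlib formalisation cell (harness21).  Prover seat hodgecm-mathlib-F0P2-p02 (g25); E1 keeper ∕ dealer F0P3a-p03 (g29), E1 BRICK
LEDGER row 27 «COMPACT-PICTURE JET @ DATUM», DELIVERABLE 2 FILE J1 (census `F0/P2/p02/g25/jet/CENSUS-JET-AT-DATUM.v1` 35cdd4c6, «=» 2026-09-03T00:44:55Z).
-/
import Literature.NumberTheory.Automorphic.SmoothInduction          -- ★ `SmoothInd`, `smoothIndRep`, `toFun_smoothIndRep_apply`, `SmoothInd.toFun_subgroup_mul`, `isSmooth_smoothInd`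
import Literature.RepresentationTheory.FirstOrderJetIntertwiner      -- ★ JET-SIGN p852846 (F0P2-p02 (g24)): `exists_representation_jet` (the jet module of a deformation pair)
import HarnessLib

/-!
# Smooth induction commutes with the unipotent-model jet: `Ind_H^G (σ ⊗ [[1, λ],[0, 1]]) ≅` the jet module of `(Ind_H^G σ, π₁)`,
# `(π₁ g v)(x) = (Λ(xg) − Λ(x))·v(xg)`, for a HEIGHT `Λ : G → k` with `Λ(hg) = λ(h) + Λ(g)` («height trivialisation»; no compact picture)

Topic `NumberTheory/Automorphic`; namespace `Representation` (dot-free theorems beside ★ `SmoothInduction`, as ★ `SmoothInductionFrobeniusNaturality`).  THEOREMS ONLY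
(no definition, no instance, no notation, no named fact, no `sorry`).  Cell `pub/hodgecm-mathlib`, crux H413 = `stmt-HodgeConjecture-24833` (`--supports` lane), E1 BRICK LEDGER
row 27 (F0P3a-p03 (g29)): the last NON-analytic line of the K4′ Ext-free spine (MEMO v2 0160dcb7: «the organ-side compact-picture identification of `i_B(N)`») and of the
K2′-π² cell («`Ĩ = i_B(N_χ)` = the jet module of `s ↦ i_B(χν^s)`»).  Seat F0P2-p02 (g25).

THE MATHEMATICS.  `G` a topological group, `H ≤ G`, `σ` a representation of `H` on `W` over a commutative ring `k`, `λ : H → k` («`lam`») and the `H`-representation `ρN` on `W × W`,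
`ρN h (w₁, w₂) = (σ h w₁, λ(h) σ h w₁ + σ h w₂)` — the jet (JET-SIGN) of the scalar deformation `(σ, λ•σ)`; for `W = k`, `σ = χ` it is the UNIPOTENT MODEL `χ ⊗ [[1, λ],[0, 1]]` of ★
`CharacterSelfExtensionModel`, i.e. the non-split self-extension `N_χ` of a character (`λ` additive = the derivative of an unramified twist `s ↦ χν^s` at `s = 0`).  A HEIGHT is a function
`Λ : G → k` with `Λ(h g) = λ(h) + Λ(g)` (`h ∈ H`), right-invariant under an OPEN subgroup `KΛ` (the Iwasawa height `log|a(g)|`, in the tree ★ `iwasawaExp` with its right-`K₀`-invariance).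
Then («HEIGHT TRIVIALISATION», no compact picture needed): for `F ∈ Ind_H^G ρN` with components `F = (F₁, F₂)`, the functions `F₁` and `F₂ − Λ·F₁` lie in `Ind_H^G σ`
(`(F₂ − ΛF₁)(hg) = σ h ((F₂ − ΛF₁)(g))` — the `λ(h)` terms cancel), and `Ψ F := (F₁, F₂ − Λ·F₁)` is a `k`-LINEAR EQUIVALENCE `Ind_H^G ρN ≃ V × V`, `V := Ind_H^G σ`, with inverse
`(v₀, v₁) ↦ (v₀, v₁ + Λ·v₀)`.  Transporting right translation: `Ψ(R_g F) = (R_g v₀, R_g v₁ + (Λ(·g) − Λ)·R_g v₀)`, i.e. `Ind_H^G ρN` IS the jet module (JET-SIGN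
`exists_representation_jet`) of the first-order deformation pair `(π₀ := Ind_H^G σ, π₁)`, **`(π₁ g v)(x) := (Λ(xg) − Λ(x)) · v(xg)`** (`π₁ 1 = 0`; the Leibniz rule is the cocycle identity
`Λ(xgh) − Λ(x) = (Λ(xgh) − Λ(xg)) + (Λ(xg) − Λ(x))`); `π₁ g` is CONSTRUCTED as `snd ∘ Ψ ∘ R_g ∘ Ψ⁻¹ ∘ inl`, so its values are smooth vectors by construction.  This is the familiar
statement «`i_P` commutes with the jet of an unramified twist» ([BernsteinZelevinsky1977, §1.9 ∕ §2.3]: induction is exact and commutes with twisting by characters of `G` trivial on … ;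
[Casselman1995, §3.1]; the first-order deformations of [Keys1984, §3]) in a form that needs neither the compact picture nor the Iwasawa decomposition — only the height.
* §1 `exists_smoothInd_fst`, `exists_smoothInd_snd_sub_height_smul`, `exists_smoothInd_of_pair` — the three component maps land in the right induced spaces.
* §2 **`exists_linearEquiv_smoothInd_unipotentModel`** (H1) — `Ψ` with its two formulas and the formula of `Ψ⁻¹`.
* §3 **`exists_deformationPair_of_height`** (H2) — `π₁` with its formula, `π₁ 1 = 0`, Leibniz in JET-SIGN's letters `π₁ (g * h) = π₁ g * π₀ h + π₀ g * π₁ h`.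
* §4 `smoothIndRep_unipotentModel_transport` (H3) and **`exists_linearEquiv_smoothInd_unipotentModel_jet`** (H4) — `Ψ (Ind ρN g F) = ρ̃ g (Ψ F)` for the jet representation `ρ̃` of `(Ind σ, π₁)`.
CONSUMERS: JET-WINDOW ★ `FirstOrderDeformationInvariantSubspace` (row 21) and TRANSVERSAL (row 26) at `π₀ := Ind_H^G σ`, this `π₁`, any invariant `A`; FILE J2 = the datum dress at
`cmBorelTriple L N v` (FN @ DATUM mould).  HONEST LABEL: count-neutral generic base layer; h413 OPEN; HC_CM is proved only modulo the 7 printed citations (2 remaining named inputs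
hLiu418 = stmt-HodgeConjecture-24832, h413 = stmt-HodgeConjecture-24833) until rung 0 closes.

## References
* [BernsteinZelevinsky1977] I. N. Bernstein, A. V. Zelevinsky, *Induced representations of reductive p-adic groups I*, Ann. Sci. ÉNS 10 (1977), §1.9, §2.3.
* [Casselman1995] W. Casselman, *Introduction to the theory of admissible representations of p-adic reductive groups* (1995), §3.1.
* [Keys1984] D. Keys, *Principal series representations of special unitary groups over local fields*, Compositio Math. 51 (1984), §3 pp. 118–119.
-/

set_option autoImplicit false

noncomputable section

namespace Representation

section UnipotentModelJet

variable {k G W : Type*} [CommRing k] [Group G] [TopologicalSpace G] [IsTopologicalGroup G] [AddCommGroup W] [Module k W]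
  (H : Subgroup G) (σ : Representation k H W) (lam : H → k) (ρN : Representation k H (W × W))
  (hρN : ∀ (h : H) (w : W × W), ρN h w = (σ h w.1, lam h • σ h w.1 + σ h w.2))
  (Λ : G → k) (hΛ : ∀ (h : H) (g : G), Λ ((h : G) * g) = lam h + Λ g)
  (KΛ : Subgroup G) (hKΛ : IsOpen (KΛ : Set G)) (hΛK : ∀ (x κ : G), κ ∈ KΛ → Λ (x * κ) = Λ x)

/-! ## §1 The component functions are induced vectors -/

section
include hρN

/-- The FIRST component `x ↦ (F x).1` of `F ∈ Ind_H^G ρN` lies in `Ind_H^G σ` (the quotient map `Ind(p)` of the jet). [cite: BernsteinZelevinsky1977, §1.9] -/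
theorem exists_smoothInd_fst (F : SmoothInd H ρN) : ∃ v : SmoothInd H σ, ∀ x, v.toFun x = (F.toFun x).1 := by
  have hmem : (fun x : G => (F.toFun x).1) ∈ coindV H.subtype σ := by
    refine (mem_indFun_iff H _ _).2 fun h g => ?_
    show (F.toFun ((h : G) * g)).1 = σ h (F.toFun g).1
    rw [SmoothInd.toFun_subgroup_mul, hρN]
  refine ⟨⟨⟨fun x : G => (F.toFun x).1, hmem⟩, ?_⟩, fun x => rfl⟩
  show (indFun H σ).IsSmoothVector _
  refine Subgroup.isOpen_mono (H₁ := (smoothIndRep H ρN).stabilizerSubgroup F) (fun g hg => ?_) (isSmooth_smoothInd H ρN F)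
  rw [mem_stabilizerSubgroup] at hg ⊢
  refine Subtype.ext (funext fun x => ?_)
  rw [indFun_apply_apply]
  show (F.toFun (x * g)).1 = (F.toFun x).1
  have hx : F.toFun (x * g) = F.toFun x := by
    have := congrArg (fun F' : SmoothInd H ρN => F'.toFun x) hg
    simpa only [toFun_smoothIndRep_apply] using this
  rw [hx]

include hΛ hKΛ hΛK

/-- The HEIGHT-CORRECTED second component `x ↦ (F x).2 − Λ(x)·(F x).1` of `F ∈ Ind_H^G ρN` lies in `Ind_H^G σ`: `(F₂ − ΛF₁)(hg) = σ h ((F₂ − ΛF₁)(g))` because the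
`λ(h)` terms CANCEL; smooth because `Λ` is right-`KΛ`-invariant. [cite: BernsteinZelevinsky1977, §1.9] [cite: Keys1984, §3 pp. 118–119] -/
theorem exists_smoothInd_snd_sub_height_smul (F : SmoothInd H ρN) :
    ∃ v : SmoothInd H σ, ∀ x, v.toFun x = (F.toFun x).2 - Λ x • (F.toFun x).1 := by
  have hmem : (fun x : G => (F.toFun x).2 - Λ x • (F.toFun x).1) ∈ coindV H.subtype σ := by
    refine (mem_indFun_iff H _ _).2 fun h g => ?_
    show (F.toFun ((h : G) * g)).2 - Λ ((h : G) * g) • (F.toFun ((h : G) * g)).1 = σ h ((F.toFun g).2 - Λ g • (F.toFun g).1)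
    rw [SmoothInd.toFun_subgroup_mul, hρN, hΛ, map_sub, map_smul]
    simp only [add_smul]
    abel
  refine ⟨⟨⟨fun x : G => (F.toFun x).2 - Λ x • (F.toFun x).1, hmem⟩, ?_⟩, fun x => rfl⟩
  show (indFun H σ).IsSmoothVector _
  refine Subgroup.isOpen_mono (H₁ := (smoothIndRep H ρN).stabilizerSubgroup F ⊓ KΛ) (fun g hg => ?_)
    ((isSmooth_smoothInd H ρN F).inter hKΛ)
  obtain ⟨hg₁, hg₂⟩ := Subgroup.mem_inf.1 hg
  rw [mem_stabilizerSubgroup] at hg₁ ⊢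
  refine Subtype.ext (funext fun x => ?_)
  rw [indFun_apply_apply]
  show (F.toFun (x * g)).2 - Λ (x * g) • (F.toFun (x * g)).1 = (F.toFun x).2 - Λ x • (F.toFun x).1
  have hx : F.toFun (x * g) = F.toFun x := by
    have := congrArg (fun F' : SmoothInd H ρN => F'.toFun x) hg₁
    simpa only [toFun_smoothIndRep_apply] using this
  rw [hx, hΛK x g hg₂]

/-- The INVERSE direction: for `v₀, v₁ ∈ Ind_H^G σ` the pair function `x ↦ (v₀ x, v₁ x + Λ(x)·v₀ x)` lies in `Ind_H^G ρN`. [cite: BernsteinZelevinsky1977, §1.9] [cite: Keys1984, §3 pp. 118–119] -/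
theorem exists_smoothInd_of_pair (v₀ v₁ : SmoothInd H σ) :
    ∃ F : SmoothInd H ρN, ∀ x, F.toFun x = (v₀.toFun x, v₁.toFun x + Λ x • v₀.toFun x) := by
  have hmem : (fun x : G => (v₀.toFun x, v₁.toFun x + Λ x • v₀.toFun x)) ∈ coindV H.subtype ρN := by
    refine (mem_indFun_iff H _ _).2 fun h g => ?_
    show (v₀.toFun ((h : G) * g), v₁.toFun ((h : G) * g) + Λ ((h : G) * g) • v₀.toFun ((h : G) * g)) = ρN h (v₀.toFun g, v₁.toFun g + Λ g • v₀.toFun g)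
    rw [hρN, SmoothInd.toFun_subgroup_mul, SmoothInd.toFun_subgroup_mul, hΛ, map_add, map_smul]
    refine Prod.ext rfl ?_
    simp only [add_smul]
    abel
  refine ⟨⟨⟨fun x : G => (v₀.toFun x, v₁.toFun x + Λ x • v₀.toFun x), hmem⟩, ?_⟩, fun x => rfl⟩
  show (indFun H ρN).IsSmoothVector _
  refine Subgroup.isOpen_mono (H₁ := ((smoothIndRep H σ).stabilizerSubgroup v₀ ⊓ (smoothIndRep H σ).stabilizerSubgroup v₁) ⊓ KΛ)
    (fun g hg => ?_) (((isSmooth_smoothInd H σ v₀).inter (isSmooth_smoothInd H σ v₁)).inter hKΛ)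
  obtain ⟨hg₀₁, hg₂⟩ := Subgroup.mem_inf.1 hg
  obtain ⟨hg₀, hg₁⟩ := Subgroup.mem_inf.1 hg₀₁
  rw [mem_stabilizerSubgroup] at hg₀ hg₁ ⊢
  refine Subtype.ext (funext fun x => ?_)
  rw [indFun_apply_apply]
  show (v₀.toFun (x * g), v₁.toFun (x * g) + Λ (x * g) • v₀.toFun (x * g)) = (v₀.toFun x, v₁.toFun x + Λ x • v₀.toFun x)
  have hx₀ : v₀.toFun (x * g) = v₀.toFun x := by
    have := congrArg (fun F' : SmoothInd H σ => F'.toFun x) hg₀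
    simpa only [toFun_smoothIndRep_apply] using this
  have hx₁ : v₁.toFun (x * g) = v₁.toFun x := by
    have := congrArg (fun F' : SmoothInd H σ => F'.toFun x) hg₁
    simpa only [toFun_smoothIndRep_apply] using this
  rw [hx₀, hx₁, hΛK x g hg₂]

end

/-! ## §2 (H1) The height trivialisation `Ψ : Ind_H^G ρN ≃ V × V` -/

section
include hρN hΛ hKΛ hΛK

/-- **(H1) HEIGHT TRIVIALISATION.**  There is a `k`-linear equivalence `Ψ : Ind_H^G ρN ≃ Ind_H^G σ × Ind_H^G σ` with `Ψ F = (F₁, F₂ − Λ·F₁)` and `Ψ⁻¹ (v₀, v₁) = (v₀, v₁ + Λ·v₀)`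
(pointwise formulas on the underlying functions). [cite: BernsteinZelevinsky1977, §1.9] [cite: Keys1984, §3 pp. 118–119] -/
theorem exists_linearEquiv_smoothInd_unipotentModel :
    ∃ Ψ : SmoothInd H ρN ≃ₗ[k] SmoothInd H σ × SmoothInd H σ,
      (∀ (F : SmoothInd H ρN) (x : G), ((Ψ F).1).toFun x = (F.toFun x).1 ∧ ((Ψ F).2).toFun x = (F.toFun x).2 - Λ x • (F.toFun x).1) ∧
      ∀ (v₀ v₁ : SmoothInd H σ) (x : G), (Ψ.symm (v₀, v₁)).toFun x = (v₀.toFun x, v₁.toFun x + Λ x • v₀.toFun x) := by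
  classical
  choose A hA using exists_smoothInd_fst H σ lam ρN hρN
  choose B hB using exists_smoothInd_snd_sub_height_smul H σ lam ρN hρN Λ hΛ KΛ hKΛ hΛK
  choose C hC using exists_smoothInd_of_pair H σ lam ρN hρN Λ hΛ KΛ hKΛ hΛK
  have hleft : ∀ F, C (A F) (B F) = F := fun F =>
    SmoothInd.ext (funext fun x => by
      rw [hC, hA, hB]
      refine Prod.ext rfl ?_
      show (F.toFun x).2 - Λ x • (F.toFun x).1 + Λ x • (F.toFun x).1 = (F.toFun x).2
      abel)
  have hright : ∀ p : SmoothInd H σ × SmoothInd H σ, (A (C p.1 p.2), B (C p.1 p.2)) = p := fun p => by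
    refine Prod.ext (SmoothInd.ext (funext fun x => ?_)) (SmoothInd.ext (funext fun x => ?_))
    · rw [hA, hC]
    · rw [hB, hC]
      show p.2.toFun x + Λ x • p.1.toFun x - Λ x • p.1.toFun x = p.2.toFun x
      abel
  have hadd : ∀ F F' : SmoothInd H ρN, (A (F + F'), B (F + F')) = (A F, B F) + (A F', B F') := fun F F' => by
    refine Prod.ext (SmoothInd.ext (funext fun x => ?_)) (SmoothInd.ext (funext fun x => ?_))
    · show (A (F + F')).toFun x = (A F + A F').toFun x
      rw [hA, SmoothInd.toFun_add, SmoothInd.toFun_add, Pi.add_apply, Pi.add_apply, hA, hA, Prod.fst_add]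
    · show (B (F + F')).toFun x = (B F + B F').toFun x
      rw [hB, SmoothInd.toFun_add, SmoothInd.toFun_add, Pi.add_apply, Pi.add_apply, hB, hB, Prod.fst_add, Prod.snd_add, smul_add]
      abel
  have hsmul : ∀ (c : k) (F : SmoothInd H ρN), (A (c • F), B (c • F)) = c • (A F, B F) := fun c F => by
    refine Prod.ext (SmoothInd.ext (funext fun x => ?_)) (SmoothInd.ext (funext fun x => ?_))
    · show (A (c • F)).toFun x = (c • A F).toFun x
      rw [hA, SmoothInd.toFun_smul, SmoothInd.toFun_smul, Pi.smul_apply, Pi.smul_apply, hA, Prod.smul_fst]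
    · show (B (c • F)).toFun x = (c • B F).toFun x
      rw [hB, SmoothInd.toFun_smul, SmoothInd.toFun_smul, Pi.smul_apply, Pi.smul_apply, hB, Prod.smul_fst, Prod.smul_snd, smul_sub,
        smul_comm c (Λ x)]
  let Ψ : SmoothInd H ρN ≃ₗ[k] SmoothInd H σ × SmoothInd H σ :=
    { toFun := fun F => (A F, B F)
      map_add' := hadd
      map_smul' := hsmul
      invFun := fun p => C p.fst p.snd
      left_inv := hleft
      right_inv := hright }
  exact ⟨Ψ, fun F x => ⟨hA F x, hB F x⟩, fun v₀ v₁ x => hC v₀ v₁ x⟩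

end

/-! ## §3 (H2) The deformation pair `(Ind_H^G σ, π₁)`, `(π₁ g v)(x) = (Λ(xg) − Λ(x))·v(xg)` -/

section
include hρN hΛ hKΛ hΛK

/-- **(H2) THE FIRST-ORDER DEFORMATION OF `Ind_H^G σ` ALONG THE HEIGHT.**  There is `π₁ : G → End_k (Ind_H^G σ)` with `(π₁ g v)(x) = (Λ(xg) − Λ(x))·v(xg)`, `π₁ 1 = 0` and the
Leibniz rule `π₁ (g h) = π₁ g * π₀ h + π₀ g * π₁ h` (`π₀ = Ind_H^G σ`; JET-SIGN's letters) — constructed as `snd ∘ Ψ ∘ R_g ∘ Ψ⁻¹ ∘ inl` with `Ψ` of (H1), so no separate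
smoothness argument is needed. [cite: Keys1984, §3 pp. 118–119] [cite: BernsteinZelevinsky1977, §2.3] -/
theorem exists_deformationPair_of_height :
    ∃ π₁ : G → Module.End k (SmoothInd H σ),
      (∀ (g : G) (v : SmoothInd H σ) (x : G), (π₁ g v).toFun x = (Λ (x * g) - Λ x) • v.toFun (x * g)) ∧
      π₁ 1 = 0 ∧ ∀ g h, π₁ (g * h) = π₁ g * smoothIndRep H σ h + smoothIndRep H σ g * π₁ h := by
  obtain ⟨Ψ, hΨ, hΨs⟩ := exists_linearEquiv_smoothInd_unipotentModel H σ lam ρN hρN Λ hΛ KΛ hKΛ hΛK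
  let π₁ : G → Module.End k (SmoothInd H σ) := fun g =>
    (LinearMap.snd k _ _) ∘ₗ Ψ.toLinearMap ∘ₗ smoothIndRep H ρN g ∘ₗ Ψ.symm.toLinearMap ∘ₗ (LinearMap.inl k _ _)
  have hπ₁ : ∀ (g : G) (v : SmoothInd H σ) (x : G), (π₁ g v).toFun x = (Λ (x * g) - Λ x) • v.toFun (x * g) := fun g v x => by
    show ((Ψ (smoothIndRep H ρN g (Ψ.symm (v, 0)))).2).toFun x = (Λ (x * g) - Λ x) • v.toFun (x * g)
    rw [(hΨ _ x).2, toFun_smoothIndRep_apply, hΨs]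
    show (0 : SmoothInd H σ).toFun (x * g) + Λ (x * g) • v.toFun (x * g) - Λ x • v.toFun (x * g) = (Λ (x * g) - Λ x) • v.toFun (x * g)
    rw [show (0 : SmoothInd H σ).toFun (x * g) = 0 from rfl, zero_add, sub_smul]
  refine ⟨π₁, hπ₁, ?_, fun g h => ?_⟩
  · refine LinearMap.ext fun v => SmoothInd.ext (funext fun x => ?_)
    rw [hπ₁, mul_one, sub_self, zero_smul]
    rfl
  · refine LinearMap.ext fun v => SmoothInd.ext (funext fun x => ?_)
    have e1 : (π₁ (g * h) v).toFun x = (Λ (x * (g * h)) - Λ x) • v.toFun (x * (g * h)) := hπ₁ _ _ _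
    have e2 : ((π₁ g * smoothIndRep H σ h + smoothIndRep H σ g * π₁ h) v).toFun x =
        (Λ (x * g) - Λ x) • v.toFun (x * g * h) + (Λ (x * g * h) - Λ (x * g)) • v.toFun (x * g * h) := by
      rw [LinearMap.add_apply, SmoothInd.toFun_add, Pi.add_apply, Module.End.mul_apply, Module.End.mul_apply, hπ₁, toFun_smoothIndRep_apply,
        toFun_smoothIndRep_apply, hπ₁]
    rw [e1, e2, ← add_smul, ← mul_assoc]
    congr 1
    abel

end

/-! ## §4 (H3)∕(H4) `Ind_H^G ρN` is the jet module of `(Ind_H^G σ, π₁)` -/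

section

/-- **(H3) TRANSPORT OF THE ACTION.**  For ANY `Ψ` with the (H1) formulas and ANY `π₁` with the (H2) formula, `Ψ (R_g F) = (R_g (Ψ F).1, π₁ g (Ψ F).1 + R_g (Ψ F).2)` — the jet action of
JET-SIGN `g·(v₀, v₁) = (π₀ g v₀, π₁ g v₀ + π₀ g v₁)` with `π₀ = Ind_H^G σ`. [cite: Keys1984, §3 pp. 118–119] [cite: BernsteinZelevinsky1977, §1.9] -/
theorem smoothIndRep_unipotentModel_transport (Ψ : SmoothInd H ρN ≃ₗ[k] SmoothInd H σ × SmoothInd H σ)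
    (hΨ : ∀ (F : SmoothInd H ρN) (x : G), ((Ψ F).1).toFun x = (F.toFun x).1 ∧ ((Ψ F).2).toFun x = (F.toFun x).2 - Λ x • (F.toFun x).1)
    (π₁ : G → Module.End k (SmoothInd H σ)) (hπ₁ : ∀ (g : G) (v : SmoothInd H σ) (x : G), (π₁ g v).toFun x = (Λ (x * g) - Λ x) • v.toFun (x * g))
    (g : G) (F : SmoothInd H ρN) :
    Ψ (smoothIndRep H ρN g F) = (smoothIndRep H σ g (Ψ F).1, π₁ g (Ψ F).1 + smoothIndRep H σ g (Ψ F).2) := by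
  refine Prod.ext (SmoothInd.ext (funext fun x => ?_)) (SmoothInd.ext (funext fun x => ?_))
  · rw [(hΨ _ x).1, toFun_smoothIndRep_apply, toFun_smoothIndRep_apply, (hΨ F (x * g)).1]
  · rw [(hΨ _ x).2, toFun_smoothIndRep_apply, SmoothInd.toFun_add, Pi.add_apply, hπ₁, toFun_smoothIndRep_apply, (hΨ F (x * g)).1,
      (hΨ F (x * g)).2, sub_smul]
    abel

include hρN hΛ hKΛ hΛK

/-- **(H4) `Ind_H^G (σ ⊗ [[1, λ],[0, 1]]) ≅ THE JET MODULE OF `(Ind_H^G σ, π₁)`.**  There are `Ψ` (H1), `π₁` (H2) and the jet representation `ρ̃` of `(Ind_H^G σ, π₁)` on `V × V` (★ JET-SIGN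
`exists_representation_jet`: `ρ̃ g (v₀, v₁) = (R_g v₀, π₁ g v₀ + R_g v₁)`) with `Ψ ∘ Ind_H^G ρN (g) = ρ̃ g ∘ Ψ` — so every statement about the jet module of a first-order deformation pair (JET-WINDOW,
TRANSVERSAL, JET-SIGN §2–§4) applies to `Ind_H^G ρN` along `Ψ`. [cite: Keys1984, §3 pp. 118–119] [cite: BernsteinZelevinsky1977, §1.9, §2.3] [cite: Casselman1995, §3.1] -/
theorem exists_linearEquiv_smoothInd_unipotentModel_jet :
    ∃ (Ψ : SmoothInd H ρN ≃ₗ[k] SmoothInd H σ × SmoothInd H σ) (π₁ : G → Module.End k (SmoothInd H σ)) (ρ : Representation k G (SmoothInd H σ × SmoothInd H σ)),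
      (∀ (F : SmoothInd H ρN) (x : G), ((Ψ F).1).toFun x = (F.toFun x).1 ∧ ((Ψ F).2).toFun x = (F.toFun x).2 - Λ x • (F.toFun x).1) ∧
      (∀ (g : G) (v : SmoothInd H σ) (x : G), (π₁ g v).toFun x = (Λ (x * g) - Λ x) • v.toFun (x * g)) ∧
      π₁ 1 = 0 ∧ (∀ g h, π₁ (g * h) = π₁ g * smoothIndRep H σ h + smoothIndRep H σ g * π₁ h) ∧
      (∀ g v₀ v₁, ρ g (v₀, v₁) = (smoothIndRep H σ g v₀, π₁ g v₀ + smoothIndRep H σ g v₁)) ∧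
      ∀ (g : G) (F : SmoothInd H ρN), Ψ (smoothIndRep H ρN g F) = ρ g (Ψ F) := by
  obtain ⟨Ψ, hΨ, -⟩ := exists_linearEquiv_smoothInd_unipotentModel H σ lam ρN hρN Λ hΛ KΛ hKΛ hΛK
  obtain ⟨π₁, hπ₁, h1, hL⟩ := exists_deformationPair_of_height H σ lam ρN hρN Λ hΛ KΛ hKΛ hΛK
  obtain ⟨ρ, hρ⟩ := Literature.RepresentationTheory.exists_representation_jet (smoothIndRep H σ) π₁ h1 hL
  refine ⟨Ψ, π₁, ρ, hΨ, hπ₁, h1, hL, hρ, fun g F => ?_⟩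
  rw [smoothIndRep_unipotentModel_transport H σ ρN Λ Ψ hΨ π₁ hπ₁ g F]
  exact (hρ g (Ψ F).1 (Ψ F).2).symm

end

end UnipotentModelJet

end Representation

end
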